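import Literature.AlgebraicGeometry.HodgeTheory.ComplexGysinCorrespondence
import Literature.AlgebraicGeometry.HodgeTheory.GysinBaseChangeOfKunneth
import Literature.AlgebraicGeometry.HodgeTheory.IsoTransport
import Literature.AlgebraicGeometry.HodgeTheory.HardLefschetzThreefold
import HarnessLib

/-!
# Stub `stub_corrActionAdjoint` of line `core-splitting-ladder` (crux `EndoscopicMiddleDegree.AlgebraicOrEnveloped`,
# stmt-HodgeConjecture-14943): the cup-adjoint of the action of an algebraic self-correspondence is the action of
# an algebraic self-correspondence

For an orientation family `μ` with Poincaré duality, `X` smooth projective of dimension `n` over `ℂ`, a class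
`γ ∈ H²ⁿ((X ⊗ X)(ℂ); ℂ)` and `x, y ∈ Hⁿ(X(ℂ); ℂ)`, the correspondence action
`P_γ x = pr₁₊(pr₂^* x ∪ γ)` (`corrAction`, Voisin II (10.7)) satisfies

  `P_γ x ∪ y = x ∪ P_{γ'} y` in `H²ⁿ(X(ℂ); ℂ)`, with `γ' := σ₊ γ`,

`σ = β_ X X : X ⊗ X ⟶ X ⊗ X` the swap of the two factors and `σ₊ = complexGysin μ … σ` its Gysin morphism
(`cupProduct_corrAction_eq`). Moreover `σ₊ γ = t • (σ⁻¹)^* γ` for a scalar `t` (`σ₊ 1 ∈ H⁰ = ℂ · 1` and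
the projection formula), so `σ₊ γ` is algebraic when `γ` is (`complexGysin_braiding_mem_algebraicClasses`;
isomorphisms pull algebraic classes back to algebraic classes, `mem_algebraicClasses_map_iff_of_iso`).
The registered stub `stub_corrActionAdjoint` (dimension `2(m+1)`, middle degree) is the special case.

Proof of the identity (Fulton, *Young Tableaux*, App. B §B.1 (5)–(6); all degrees of `x`, `y` equal `n`, the
two Koszul signs `(-1)^{n·n}` cancel):
* `P_γ x ∪ y = ± y ∪ pr₁₊(pr₂^* x ∪ γ) = ± pr₁₊(pr₁^* y ∪ (pr₂^* x ∪ γ)) = pr₁₊(pr₂^* x ∪ (pr₁^* y ∪ γ))`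
  (projection formula `complexGysin_cup`, associativity and graded commutativity of `∪`);
* `pr₂^* y ∪ σ₊ γ = σ₊(σ^* pr₂^* y ∪ γ) = σ₊(pr₁^* y ∪ γ)` (projection formula for `σ`, `σ ≫ pr₂ = pr₁`),
  `pr₁₊ ∘ σ₊ = (σ ≫ pr₁)₊ = pr₂₊` (`complexGysin_comp`, `σ ≫ pr₁ = pr₂`), so
  `x ∪ P_{σ₊γ} y = x ∪ pr₂₊(pr₁^* y ∪ γ) = pr₂₊(pr₂^* x ∪ (pr₁^* y ∪ γ))`;
* `pr₁₊ w = pr₂₊ w` for EVERY top-degree class `w ∈ H⁴ⁿ((X ⊗ X)(ℂ); ℂ)` (`complexGysin_apply_eq_of_top`): both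
  are Poincaré dual to `prᵢ(ℂ)_* (w ⌢ [X ⊗ X])` in `H₀(X(ℂ); ℂ)` (`capProduct_complexGysin`), these two degree-`0`
  classes have the same augmentation (`singularHomology.map_ε`), and the augmentation of the path-connected
  `X(ℂ)` (`connectedSpace_complexPoints` + manifold charts) is an isomorphism (Hatcher Prop. 2.7).

References: W. Fulton, Young Tableaux (1997), App. B §B.1 (5)–(6); C. Voisin, Hodge Theory and Complex Algebraic
Geometry II (2003), proof of Thm. 10.17 (10.7); A. Hatcher, Algebraic Topology (2002), Prop. 2.7, Thm. 3.30.
-/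

noncomputable section

-- The mandated namespace `Summit.<P>.<Sub>.Theorems.…` repeats `HodgeConjecture` (single-conjunct summit).
set_option linter.dupNamespace false

namespace Summit.HodgeConjecture.HodgeConjecture.Theorems.CoreSplittingLadder

open CategoryTheory MonoidalCategory CartesianMonoidalCategory
open Literature.AlgebraicGeometry.Motives (SchemeOver ComplexPoints IsSmoothProjective)
open Literature.AlgebraicGeometry.HodgeTheory
open Literature.AlgebraicTopology.SingularHomology

/-- **Top-degree Gysin push-forwards do not depend on the morphism.** For `Y`, `X` smooth projective of
dimensions `m`, `n`, two morphisms `f g : Y ⟶ X` and a class `w` of top degree `2m` on `Y(ℂ)`,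
`f₊ w = g₊ w` in `H^{2n}(X(ℂ); ℂ)`: by the defining square `f₊ w ⌢ [X(ℂ)] = f(ℂ)_* (w ⌢ [Y(ℂ)])` both sides are
Poincaré dual (`⌢ [X(ℂ)]` is injective) to degree-`0` homology classes with the same augmentation
`ε (w ⌢ [Y(ℂ)])` (`ε ∘ f(ℂ)_* = ε`), and `ε : H₀(X(ℂ); ℂ) → ℂ` is an isomorphism because the closed manifold
`X(ℂ)` is connected, hence path connected. [cite: FultonYoungTableaux1997, Appendix B §B.1 (5)]
[cite: HatcherAT2002, §2.1 Prop. 2.7 and §3.3 Thm. 3.30] -/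
theorem complexGysin_apply_eq_of_top (μ : OrientationFamily) (hμ : μ.HasPoincareDuality) {m n : ℕ}
    {Y X : SchemeOver ℂ} (hY : IsSmoothProjective m Y) (hX : IsSmoothProjective n X) (f g : Y ⟶ X)
    {a b : ℕ} (hab : a + 2 * n = b + 2 * m) (ha : a = 2 * m) (w : complexBetti Y a) :
    complexGysin μ hY hX f hab w = complexGysin μ hY hX g hab w := by
  have ha' : a + 0 = 2 * m := by omega
  have hb' : b + 0 = 2 * n := by omega
  letI := hX.chartedSpace
  haveI := connectedSpace_complexPoints hX
  haveI : LocallyPathConnectedSpace (ComplexPoints X) :=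
    ChartedSpace.locallyPathConnectedSpace (H := EuclideanSpace ℝ (Fin (2 * n))) (M := ComplexPoints X)
  haveI : PathConnectedSpace (ComplexPoints X) := pathConnectedSpace_iff_connectedSpace.2 inferInstance
  haveI := singularHomology.isIso_ε_of_pathConnectedSpace ℂ ℂ (X := ComplexPoints X)
  apply (hμ hX hb').1
  rw [poincareDualityMap_apply, poincareDualityMap_apply, capProduct_complexGysin hμ hY hX f hab ha' hb',
    capProduct_complexGysin hμ hY hX g hab ha' hb']
  apply (ModuleCat.mono_iff_injective (singularHomology.ε ℂ ℂ (ComplexPoints X))).1 inferInstance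
  rw [← CategoryTheory.comp_apply, ← CategoryTheory.comp_apply, singularHomology.map_ε,
    singularHomology.map_ε]

/-- **`σ₊ γ = t • (σ⁻¹)^* γ` for the swap `σ = β_ X X` of `X ⊗ X`** (`X ⊗ X` smooth projective of dimension
`d`, `γ` of any degree `i`): `γ = σ^*((σ⁻¹)^* γ)`, so by the projection formula
`σ₊ γ = σ₊(σ^*((σ⁻¹)^* γ) ∪ 1) = (σ⁻¹)^* γ ∪ σ₊ 1`, and `σ₊ 1 ∈ H⁰((X ⊗ X)(ℂ); ℂ) = ℂ · 1`
(`exists_eq_smul_one`, the variety being connected). [cite: FultonYoungTableaux1997, Appendix B §B.1 (6)]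
[cite: HatcherAT2002, §3.3 Thm. 3.26] -/
theorem complexGysin_braiding_eq_smul (μ : OrientationFamily) (hμ : μ.HasPoincareDuality) {d : ℕ}
    {X : SchemeOver ℂ} (hT : IsSmoothProjective d (X ⊗ X)) {i : ℕ} (hi : i + 2 * d = i + 2 * d)
    (γ : complexBetti (X ⊗ X) i) :
    ∃ t : ℂ, complexGysin μ hT hT (β_ X X).hom hi γ = t • complexBetti.map (β_ X X).inv i γ := by
  obtain ⟨t, ht⟩ := exists_eq_smul_one μ hT
    (complexGysin μ hT hT (β_ X X).hom (rfl : 0 + 2 * d = 0 + 2 * d)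
      (singularCohomology.one ℂ (ComplexPoints (X ⊗ X))))
  refine ⟨t, ?_⟩
  have key := complexGysin_cup hμ hT hT (β_ X X).hom (Nat.add_zero i) hi
    (rfl : 0 + 2 * d = 0 + 2 * d) (Nat.add_zero i) (complexBetti.map (β_ X X).inv i γ)
    (singularCohomology.one ℂ (ComplexPoints (X ⊗ X)))
  rw [cupProduct_one, (β_ X X).complexBetti_map_hom_map_inv, ht, map_smul, cupProduct_one] at key
  exact key

/-- **The swap push-forward of an algebraic class is algebraic**: for `γ ∈ Nᵖ H²ᵖ((X ⊗ X)(ℂ); ℂ)`,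
`σ₊ γ = t • (σ⁻¹)^* γ` (`complexGysin_braiding_eq_smul`) lies in `Nᵖ H²ᵖ` as well, since isomorphisms pull
algebraic classes back to algebraic classes (`mem_algebraicClasses_map_iff_of_iso`) and `Nᵖ H²ᵖ` is a
`ℂ`-subspace. [cite: GrothendieckTopology1969, §1] [cite: FultonYoungTableaux1997, Appendix B §B.1 (6)] -/
theorem complexGysin_braiding_mem_algebraicClasses (μ : OrientationFamily) (hμ : μ.HasPoincareDuality)
    {d p : ℕ} {X : SchemeOver ℂ} (hT : IsSmoothProjective d (X ⊗ X)) (hi : 2 * p + 2 * d = 2 * p + 2 * d)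
    {γ : complexBetti (X ⊗ X) (2 * p)} (hγ : γ ∈ algebraicClasses (X ⊗ X) p) :
    complexGysin μ hT hT (β_ X X).hom hi γ ∈ algebraicClasses (X ⊗ X) p := by
  obtain ⟨t, ht⟩ := complexGysin_braiding_eq_smul μ hμ hT hi γ
  rw [ht]
  exact Submodule.smul_mem _ t ((mem_algebraicClasses_map_iff_of_iso (β_ X X).symm).2 hγ)

/-- **The cup-adjoint of `P_γ` is `P_{σ₊γ}`.** For `μ` with Poincaré duality, `X` smooth projective of dimension
`n` (and `X ⊗ X` of dimension `n + n`), `γ ∈ H²ⁿ((X ⊗ X)(ℂ); ℂ)` and `x, y ∈ Hⁿ(X(ℂ); ℂ)`: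
`P_γ x ∪ y = x ∪ P_{σ₊γ} y` in `Hᵏ(X(ℂ); ℂ)` (`k = n + n`), where `P_γ = corrAction μ hX hX _ γ = pr₁₊(pr₂^*(·) ∪ γ)`
and `σ₊ γ = complexGysin μ hT hT (β_ X X).hom _ γ`. Projection formula (`complexGysin_cup`) on both sides,
`σ ≫ pr₂ = pr₁`, `pr₁₊ ∘ σ₊ = (σ ≫ pr₁)₊ = pr₂₊` (`complexGysin_comp`), associativity and graded commutativity
of `∪` (the two signs `(-1)^{n·n}` cancel), and `pr₁₊ = pr₂₊` on the top degree of `(X ⊗ X)(ℂ)`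
(`complexGysin_apply_eq_of_top`). [cite: FultonYoungTableaux1997, Appendix B §B.1 (5)–(6)]
[cite: VoisinHodgeII2003, proof of Thm. 10.17 (10.7)] -/
theorem cupProduct_corrAction_eq (μ : OrientationFamily) (hμ : μ.HasPoincareDuality) {n : ℕ}
    {X : SchemeOver ℂ} (hX : IsSmoothProjective n X) (hT : IsSmoothProjective (n + n) (X ⊗ X)) {k : ℕ}
    (hk : n + n = k) (hab : n + 2 * n = n + 2 * n) (γ : complexBetti (X ⊗ X) (2 * n))
    (x y : complexBetti X n) :
    cupProduct hk (corrAction μ hX hX hab γ x) y =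
      cupProduct hk x (corrAction μ hX hX hab
        (complexGysin μ hT hT (β_ X X).hom (rfl : 2 * n + 2 * (n + n) = 2 * n + 2 * (n + n)) γ) y) := by
  -- degree bookkeeping
  have hd : n + 2 * n + 2 * n = n + 2 * (n + n) := by omega
  have hd' : n + 2 * n + 2 * (n + n) = n + 2 * n + 2 * (n + n) := rfl
  have h' : n + (n + 2 * n) + 2 * n = k + 2 * (n + n) := by omega
  have h3 : k + 2 * n = n + (n + 2 * n) := by omega
  -- `σ^* pr₂^* = pr₁^*`
  have e1 : complexBetti.map (β_ X X).hom n (complexBetti.map (snd X X) n y) =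
      complexBetti.map (fst X X) n y := by
    rw [← CategoryTheory.comp_apply, ← complexBetti.map_comp, braiding_hom_snd]
  -- the left-hand side: `pr₁₊(pr₂^* x ∪ (pr₁^* y ∪ γ))`
  have hL : cupProduct hk (corrAction μ hX hX hab γ x) y =
      complexGysin μ hT hX (fst X X) h'
        (cupProduct rfl (complexBetti.map (snd X X) n x)
          (cupProduct rfl (complexBetti.map (fst X X) n y) γ)) := by
    rw [cupProduct_gradedComm_holds ℂ _ hk hk (corrAction μ hX hX hab γ x) y, corrAction_apply,
      ← complexGysin_cup hμ hT hX (fst X X) rfl h' hd hk y,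
      ← cupProduct_assoc hk (rfl : n + 2 * n = n + 2 * n) h3 rfl (complexBetti.map (fst X X) n y)
        (complexBetti.map (snd X X) n x) γ,
      cupProduct_gradedComm_holds ℂ _ hk hk (complexBetti.map (fst X X) n y)
        (complexBetti.map (snd X X) n x),
      map_smul, LinearMap.smul_apply, map_smul, smul_smul, ← pow_add,
      Even.neg_one_pow ⟨n * n, rfl⟩, one_smul,
      cupProduct_assoc hk (rfl : n + 2 * n = n + 2 * n) h3 rfl (complexBetti.map (snd X X) n x)
        (complexBetti.map (fst X X) n y) γ]
  -- the right-hand side: `pr₂₊(pr₂^* x ∪ (pr₁^* y ∪ γ))`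
  have hR : cupProduct hk x (corrAction μ hX hX hab
        (complexGysin μ hT hT (β_ X X).hom (rfl : 2 * n + 2 * (n + n) = 2 * n + 2 * (n + n)) γ) y) =
      complexGysin μ hT hX (snd X X) h'
        (cupProduct rfl (complexBetti.map (snd X X) n x)
          (cupProduct rfl (complexBetti.map (fst X X) n y) γ)) := by
    -- `pr₂^* y ∪ σ₊ γ = σ₊(pr₁^* y ∪ γ)`
    have e2 : cupProduct (rfl : n + 2 * n = n + 2 * n) (complexBetti.map (snd X X) n y)
          (complexGysin μ hT hT (β_ X X).hom (rfl : 2 * n + 2 * (n + n) = 2 * n + 2 * (n + n)) γ) =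
        complexGysin μ hT hT (β_ X X).hom hd' (cupProduct rfl (complexBetti.map (fst X X) n y) γ) := by
      rw [← complexGysin_cup hμ hT hT (β_ X X).hom rfl hd' rfl rfl (complexBetti.map (snd X X) n y) γ, e1]
    -- `pr₁₊ ∘ σ₊ = pr₂₊`
    have e3 : ∀ z, complexGysin μ hT hX (fst X X) hd (complexGysin μ hT hT (β_ X X).hom hd' z) =
        complexGysin μ hT hX (snd X X) hd z := by
      intro z
      have hc := LinearMap.congr_fun (complexGysin_comp hμ hT hT hX (β_ X X).hom (fst X X) hd' hd) z
      rw [LinearMap.comp_apply] at hc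
      rw [← hc]
      simp only [braiding_hom_fst]
    rw [corrAction_apply, e2, e3, ← complexGysin_cup hμ hT hX (snd X X) rfl h' hd hk x]
  rw [hL, hR]
  exact complexGysin_apply_eq_of_top μ hμ hT hX (fst X X) (snd X X) h' (by omega) _

/-- **Stub A of line `core-splitting-ladder` — the cup-adjoint of the action of an algebraic self-correspondence is
the action of an algebraic self-correspondence.** For `μ` with Poincaré duality, `X` smooth projective of
dimension `2(m+1)` and `γ ∈ N^{2(m+1)} H^{4(m+1)}((X ⊗ X)(ℂ); ℂ)` algebraic, `γ' := σ₊ γ` (`σ = β_ X X` the swap of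
the factors) is algebraic (`complexGysin_braiding_mem_algebraicClasses`) and `P_γ x ∪ y = x ∪ P_{γ'} y` for all
middle-degree `x`, `y` (`cupProduct_corrAction_eq`). [cite: FultonYoungTableaux1997, Appendix B §B.1 (5)–(6)]
[cite: VoisinHodgeII2003, proof of Thm. 10.17 (10.7)] -/
theorem stub_corrActionAdjoint :
    ∀ (μ : OrientationFamily), μ.HasPoincareDuality →
      ∀ (m : ℕ) (X : SchemeOver ℂ) (hX : IsSmoothProjective (2 * (m + 1)) X)
        (γ : complexBetti (X ⊗ X) (2 * (2 * (m + 1)))), γ ∈ algebraicClasses (X ⊗ X) (2 * (m + 1)) →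
        ∃ γ' ∈ algebraicClasses (X ⊗ X) (2 * (m + 1)),
          ∀ x y : complexBetti X (2 * (m + 1)),
            cupProduct (two_mul_add_two_mul (m + 1) (m + 1))
                (corrAction μ hX hX
                  (rfl : 2 * (m + 1) + 2 * (2 * (m + 1)) = 2 * (m + 1) + 2 * (2 * (m + 1))) γ x) y =
              cupProduct (two_mul_add_two_mul (m + 1) (m + 1)) x
                (corrAction μ hX hX
                  (rfl : 2 * (m + 1) + 2 * (2 * (m + 1)) = 2 * (m + 1) + 2 * (2 * (m + 1))) γ' y) := by
  intro μ hμ m X hX γ hγ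
  exact ⟨_, complexGysin_braiding_mem_algebraicClasses μ hμ
      (Literature.AlgebraicGeometry.Motives.IsSmoothProjective.tensor_holds hX hX) rfl hγ,
    fun x y ↦ cupProduct_corrAction_eq μ hμ hX
      (Literature.AlgebraicGeometry.Motives.IsSmoothProjective.tensor_holds hX hX) _ _ γ x y⟩

end Summit.HodgeConjecture.HodgeConjecture.Theorems.CoreSplittingLadder

end
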